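import Literature.Computability.Complexity.IntPairBricks
import Literature.Computability.Complexity.StackIntsMul
import Literature.Computability.Complexity.StackNumeric
import Literature.Computability.Complexity.LengthCompare
import HarnessLib

/-!
# Signed-integer bricks, II: canonical form, subtraction, comparison, `Int.ediv`, saturation

Trunk `CplxCore`, continuing `IntPairBricks.lean` (integers in the `FP` string algebra as
difference pairs `⟨P, Q⟩` of numerals, value `ival w = ⟦P⟧ - ⟦Q⟧`, canonical code `dpEnc z`, the
total sum `iaddFn` and product `imulFn`) and `StackIntsMul.lean` (the canonical components
`Com.cP`, `Com.cQ` and the floor-division identities `Com.pfdiv_canonical`). A machine that stores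
integers between rounds of a loop (the LLL basis-reduction machine, `Algebra/EuclideanLattices`)
needs them in **canonical** form — so that the length of a code is the binary size of its value —
and needs the remaining operations of an integer ALU, each again a *total* string function with a
closed-form value:

* `zcanonF w = dpEnc (ival w)` on every `w` (one truncated subtraction each way,
  `⟨P ∸ Q, Q ∸ P⟩`); `zaddF = zcanonF ∘ iaddFn`, `zmulF = zcanonF ∘ imulFn`, `znegF`, `zsubF`
  (`… ⟨a, b⟩ = dpEnc (ival a ∘ ival b)` for `+, ·, -`), the one-bit comparison
  `zleF ⟨a, b⟩ = [ival a ≤ ival b]`, and on canonical operands `zabsF (dpEnc z) = dpEnc |z|`;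
* `zedivF ⟨dpEnc x, dpEnc d⟩ = dpEnc (x / d)` with exactly Lean's `Int.ediv` conventions (floor for
  `d > 0`, `x / (-d) = -(x / d)`, `x / 0 = 0`), from `divFn` by `⌊-q/d⌋ = -⌈q/d⌉ = -((q + d - 1)/d)`;
* `zcapF ⟨x, a⟩`: **saturation at width `|x|`** — the canonical form of `a` if
  `|bin (⟦P⟧ + ⟦Q⟧)| ≤ |x|` (for canonical `a`: `|ival a| < 2^{|x|}`), else `dpEnc 0`; its output never
  exceeds `2|x| + 2` symbols whatever `a` is, which is how a machine keeps its registers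
  polynomially bounded on malformed inputs too;
* the sign–magnitude entry code `⟨[z < 0], bin |z|⟩` of `encodingIntBool`: `ofSMFn` of
  `IntPairBricks.lean` lands exactly on `dpEnc` (`ofSMFn_encode`), and `signMagOfZF` goes back;
* length bookkeeping: `zlen w = |P| + |Q| ≤ |w|`, `|dpEnc z| ≤ 2 |bin |z|| + 2`, and the output
  lengths of the bricks in terms of `zlen` of the operands.

## References

* D. E. Knuth, *The Art of Computer Programming*, Vol. 2, 3rd ed., Addison-Wesley 1998, §4.3.1
  (multiple-precision arithmetic; signed numbers). (Not held; schoolbook, fully proved here.)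
* S. Arora, B. Barak, *Computational Complexity: A Modern Approach*, CUP 2009, §1.3 (polynomial
  time is closed under composition), §0.1 (pairing).
-/

namespace Literature.Computability.Complexity

open _root_.Computability Polynomial

namespace Brick

/-! ### The canonical code and the components of `StackIntsMul.lean` -/

/-- The canonical code is the pair of the canonical components `cP`, `cQ` of `StackIntsMul.lean`.
[folklore] -/
theorem dpEnc_eq (z : ℤ) : dpEnc z = boolPair (Com.cP z) (Com.cQ z) := by
  unfold dpEnc Com.cP Com.cQ
  by_cases h : z < 0
  · rw [if_pos h, if_pos h, Int.toNat_of_nonpos h.le, TokConv.encodeNat_zero']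
    congr 2; omega
  · rw [if_neg h, if_neg h, show (-z).toNat = 0 by omega, TokConv.encodeNat_zero']
    congr 2; omega

/-- `dpEnc` is injective. [folklore] -/
theorem dpEnc_injective : Function.Injective dpEnc := fun a b h => by
  have := congrArg ival h; simpa using this

/-- The canonical code of `p - q` for naturals `p`, `q`, written with truncated subtractions:
`dpEnc (p - q) = ⟨bin (p ∸ q), bin (q ∸ p)⟩`. [folklore] -/
theorem dpEnc_sub_natCast (p q : ℕ) : dpEnc ((p : ℤ) - q) = boolPair (encodeNat (p - q)) (encodeNat (q - p)) := by
  unfold dpEnc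
  congr 2 <;> omega

/-- The total numeral length of a difference pair: `|P| + |Q|`. [folklore] -/
def zlen (w : List Bool) : ℕ := (fstF w).length + (sndF w).length

/-- `zlen` of a pair. [folklore] -/
@[simp] theorem zlen_boolPair (p q : List Bool) : zlen (boolPair p q) = p.length + q.length := by
  simp [zlen]

/-- `zlen (dpEnc z) = |bin |z||`. [folklore] -/
theorem zlen_dpEnc (z : ℤ) : zlen (dpEnc z) = (encodeNat z.natAbs).length := by
  rw [dpEnc_eq, zlen_boolPair, Com.length_cP_add_length_cQ]

/-- `|dpEnc z| ≤ 2 |bin |z|| + 2`. [folklore] -/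
theorem length_dpEnc_le_two_mul (z : ℤ) : (dpEnc z).length ≤ 2 * (encodeNat z.natAbs).length + 2 := by
  rw [dpEnc_eq, length_boolPair]
  have := Com.length_cP_add_length_cQ z
  omega

/-- `dpEnc 0 = ⟨ε, ε⟩`. [folklore] -/
theorem dpEnc_zero : dpEnc 0 = boolPair [] [] := rfl

/-- `zlen w ≤ |w|`. [folklore] -/
theorem zlen_le_length (w : List Bool) : zlen w ≤ w.length := by
  have := length_fstF_sndF_le w; unfold zlen; omega

/-- The binary size of a numeral's value is at most its length. [folklore] -/
theorem size_bitsToNat_le (w : List Bool) : (bitsToNat w).size ≤ w.length := by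
  rw [← TM2Pass.length_encodeNat_eq_size]; exact length_encodeNat_bitsToNat_le w

/-- `|bin |ival w|| ≤ zlen w`: the magnitude of the value has at most `|P| + |Q|` bits. [folklore] -/
theorem length_encodeNat_natAbs_ival_le (w : List Bool) : (encodeNat (ival w).natAbs).length ≤ zlen w := by
  rw [TM2Pass.length_encodeNat_eq_size]
  unfold ival zlen
  have h1 := size_bitsToNat_le (fstF w)
  have h2 := size_bitsToNat_le (sndF w)
  have : (ival w).natAbs ≤ max (bitsToNat (fstF w)) (bitsToNat (sndF w)) := by unfold ival; omega
  calc ((bitsToNat (fstF w) : ℤ) - bitsToNat (sndF w)).natAbs.size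
      ≤ (max (bitsToNat (fstF w)) (bitsToNat (sndF w))).size := Nat.size_le_size this
    _ ≤ _ := by
      rcases le_total (bitsToNat (fstF w)) (bitsToNat (sndF w)) with h | h
      · rw [max_eq_right h]; omega
      · rw [max_eq_left h]; omega

/-- `bin m = ε ↔ m = 0`; the non-trivial direction is `Com.eq_zero_of_encodeNat_eq_nil`
(`StackWordArith.lean`, the survivor for a librarian hoist; further copies `TavRecode.encodeNat_eq_nil_iff`,
`GapCVPPrime.encodeNat_eq_nil_iff` live in files not importable here). [folklore] -/
theorem encodeNat_eq_nil_iff (m : ℕ) : encodeNat m = [] ↔ m = 0 :=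
  ⟨Com.eq_zero_of_encodeNat_eq_nil, by rintro rfl; rfl⟩

/-- A nonzero natural has a nonempty numeral (from `Com.eq_zero_of_encodeNat_eq_nil`; cf. the twin
`StockMachine.encodeNat_ne_nil`, not importable here). [folklore] -/
theorem encodeNat_ne_nil_of_pos {m : ℕ} (hm : 0 < m) : encodeNat m ≠ [] := fun h =>
  hm.ne' (Com.eq_zero_of_encodeNat_eq_nil h)

/-! ### Canonical form, addition, negation, subtraction, multiplication, comparison -/

/-- **Canonical form**: `⟨P, Q⟩ ↦ ⟨P ∸ Q, Q ∸ P⟩`. [cite: KnuthTAOCP2, §4.3.1] -/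
noncomputable def zcanonF : List Bool → List Bool := fanoutFn subFn (subFn ∘ fanoutFn sndF fstF)

/-- **`zcanonF w = dpEnc (ival w)` on every input.** [folklore] -/
@[simp] theorem zcanonF_eq (w : List Bool) : zcanonF w = dpEnc (ival w) := by
  rw [ival, dpEnc_sub_natCast]
  simp [zcanonF, subFn, fstF, sndF]

/-- `zcanonF ∈ FP`. [folklore] -/
theorem zcanonF_mem_FP : zcanonF ∈ FP :=
  fanoutFn_mem_FP subFn_mem_FP (comp_mem_FP subFn_mem_FP (fanoutFn_mem_FP sndF_mem_FP fstF_mem_FP))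

/-- **Addition** (canonical): `zcanonF ∘ iaddFn`. [cite: KnuthTAOCP2, §4.3.1] -/
noncomputable def zaddF : List Bool → List Bool := zcanonF ∘ iaddFn

/-- **`zaddF ⟨a, b⟩ = dpEnc (ival a + ival b)`** (all `a`, `b`). [folklore] -/
@[simp] theorem zaddF_boolPair (a b : List Bool) : zaddF (boolPair a b) = dpEnc (ival a + ival b) := by
  rw [zaddF, Function.comp_apply, zcanonF_eq, ival_iaddFn_boolPair]

/-- `zaddF ∈ FP`. [folklore] -/
theorem zaddF_mem_FP : zaddF ∈ FP := comp_mem_FP zcanonF_mem_FP iaddFn_mem_FP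

/-- Swapping the components of a pair code (negation without canonicalisation). [folklore] -/
noncomputable def zswapF : List Bool → List Bool := fanoutFn sndF fstF

/-- `ival (zswapF a) = - ival a` on every input. [folklore] -/
@[simp] theorem ival_zswapF (a : List Bool) : ival (zswapF a) = - ival a := by
  simp [zswapF, ival]

/-- `zswapF (dpEnc z) = dpEnc (-z)`. [folklore] -/
@[simp] theorem zswapF_dpEnc (z : ℤ) : zswapF (dpEnc z) = dpEnc (-z) := by
  rw [zswapF, dpEnc_eq, fanoutFn_apply, fstF_boolPair, sndF_boolPair, dpEnc_eq, Com.cP_neg, Com.cQ_neg]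

/-- `zswapF ∈ FP`. [folklore] -/
theorem zswapF_mem_FP : zswapF ∈ FP := fanoutFn_mem_FP sndF_mem_FP fstF_mem_FP

/-- **Negation** (canonical): swap and canonicalise. [folklore] -/
noncomputable def znegF : List Bool → List Bool := zcanonF ∘ zswapF

/-- `znegF a = dpEnc (- ival a)`. [folklore] -/
@[simp] theorem znegF_eq (a : List Bool) : znegF a = dpEnc (- ival a) := by
  rw [znegF, Function.comp_apply, zcanonF_eq, ival_zswapF]

/-- `znegF ∈ FP`. [folklore] -/
theorem znegF_mem_FP : znegF ∈ FP := comp_mem_FP zcanonF_mem_FP zswapF_mem_FP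

/-- **Subtraction** (canonical): add the swapped second operand. [cite: KnuthTAOCP2, §4.3.1] -/
noncomputable def zsubF : List Bool → List Bool := zaddF ∘ fanoutFn fstF (zswapF ∘ sndF)

/-- `zsubF ⟨a, b⟩ = dpEnc (ival a - ival b)`. [folklore] -/
@[simp] theorem zsubF_boolPair (a b : List Bool) : zsubF (boolPair a b) = dpEnc (ival a - ival b) := by
  rw [zsubF, Function.comp_apply, fanoutFn_apply, fstF_boolPair, Function.comp_apply, sndF_boolPair, zaddF_boolPair,
    ival_zswapF, sub_eq_add_neg]

/-- `zsubF ∈ FP`. [folklore] -/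
theorem zsubF_mem_FP : zsubF ∈ FP :=
  comp_mem_FP zaddF_mem_FP (fanoutFn_mem_FP fstF_mem_FP (comp_mem_FP zswapF_mem_FP sndF_mem_FP))

/-- **Multiplication** (canonical): `zcanonF ∘ imulFn`. [cite: KnuthTAOCP2, §4.3.1] -/
noncomputable def zmulF : List Bool → List Bool := zcanonF ∘ imulFn

/-- `zmulF ⟨a, b⟩ = dpEnc (ival a * ival b)`. [folklore] -/
@[simp] theorem zmulF_boolPair (a b : List Bool) : zmulF (boolPair a b) = dpEnc (ival a * ival b) := by
  rw [zmulF, Function.comp_apply, zcanonF_eq, ival_imulFn_boolPair]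

/-- `zmulF ∈ FP`. [folklore] -/
theorem zmulF_mem_FP : zmulF ∈ FP := comp_mem_FP zcanonF_mem_FP imulFn_mem_FP

/-- **Comparison** (one bit): `a ≤ b` iff `a - b` is not positive. [folklore] -/
noncomputable def zleF : List Bool → List Bool := notFn (iposFn ∘ zsubF)

/-- `zleF ⟨a, b⟩ = [ival a ≤ ival b]`. [folklore] -/
@[simp] theorem zleF_boolPair (a b : List Bool) : zleF (boolPair a b) = [decide (ival a ≤ ival b)] := by
  rw [zleF, notFn_apply (b := decide (0 < ival a - ival b)) (by simp)]
  congr 1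
  by_cases h : ival a ≤ ival b
  · simp [h]
  · simp [h]; omega

/-- `zleF` is a one-bit test. [folklore] -/
theorem oneBit_zleF : OneBit zleF := oneBit_notFn (oneBit_iposFn.comp _)

/-- `zleF ∈ FP`. [folklore] -/
theorem zleF_mem_FP : zleF ∈ FP := notFn_mem_FP (comp_mem_FP iposFn_mem_FP zsubF_mem_FP)

/-- **Absolute value** on canonical codes: `⟨P, Q⟩ ↦ ⟨bin (P + Q), ε⟩`. [folklore] -/
noncomputable def zabsF : List Bool → List Bool := fanoutFn addFn (fun _ => [])

/-- The two canonical components together carry the magnitude. [folklore] -/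
theorem bitsToNat_cP_add_cQ (z : ℤ) : bitsToNat (Com.cP z) + bitsToNat (Com.cQ z) = z.natAbs := by
  unfold Com.cP Com.cQ; split_ifs <;> simp [bitsToNat_encodeNat]

/-- `zabsF (dpEnc z) = dpEnc |z|`. [folklore] -/
@[simp] theorem zabsF_dpEnc (z : ℤ) : zabsF (dpEnc z) = dpEnc |z| := by
  rw [zabsF, fanoutFn_apply, dpEnc_eq, addFn_boolPair, bitsToNat_cP_add_cQ]
  unfold dpEnc
  rw [Int.abs_eq_natAbs, Int.toNat_natCast, Int.toNat_neg_natCast, TokConv.encodeNat_zero']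

/-- `zabsF ∈ FP`. [folklore] -/
theorem zabsF_mem_FP : zabsF ∈ FP := fanoutFn_mem_FP addFn_mem_FP (const_mem_FP _)

/-- The constant `dpEnc 0`. [folklore] -/
theorem zzero_mem_FP : (fun _ : List Bool => dpEnc 0) ∈ FP := const_mem_FP _

/-! ### Division with `Int.ediv` semantics -/

/-- The numeral `D - 1` of the second field. [folklore] -/
noncomputable def predSndF : List Bool → List Bool := subFn ∘ fanoutFn sndF (fun _ => [true])

/-- `predSndF ⟨a, D⟩ = bin (⟦D⟧ - 1)`. [folklore] -/
@[simp] theorem predSndF_boolPair (a D : List Bool) : predSndF (boolPair a D) = encodeNat (bitsToNat D - 1) := by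
  simp [predSndF]

/-- **Floor division of a canonical pair by a positive numeral** `⟨a, D⟩ ↦ ⟨⟦aP⟧ / ⟦D⟧, ⌈⟦aQ⟧ / ⟦D⟧⌉⟩`,
the ceiling computed as `(⟦aQ⟧ + ⟦D⟧ - 1) / ⟦D⟧`. [cite: KnuthTAOCP2, §4.3.1] -/
noncomputable def zquoPosF : List Bool → List Bool :=
  fanoutFn (divFn ∘ fanoutFn (fstF ∘ fstF) sndF)
    (divFn ∘ fanoutFn (addFn ∘ fanoutFn (sndF ∘ fstF) predSndF) sndF)

/-- `zquoPosF ⟨dpEnc x, D⟩ = dpEnc (x / ⟦D⟧)` for `⟦D⟧ > 0`. [folklore] -/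
theorem zquoPosF_dpEnc (x : ℤ) (D : List Bool) (hD : 0 < bitsToNat D) :
    zquoPosF (boolPair (dpEnc x) D) = dpEnc (x / (bitsToNat D : ℕ)) := by
  obtain ⟨h1, h2⟩ := Com.pfdiv_canonical x (bitsToNat D) hD
  have e : zquoPosF (boolPair (dpEnc x) D) =
      boolPair (encodeNat (bitsToNat (Com.cP x) / bitsToNat D))
        (encodeNat ((bitsToNat (Com.cQ x) + (bitsToNat D - 1)) / bitsToNat D)) := by
    simp [zquoPosF, dpEnc_eq, divFn, addFn, fstF, sndF]
  have hpar : bitsToNat (Com.cQ x) + (bitsToNat D - 1) = bitsToNat (Com.cQ x) + bitsToNat D - 1 := by omega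
  rw [e, h1, hpar, ← Nat.ceilDiv_eq_add_pred_div, ← Com.ceilDivNat_eq_ceilDiv _ _ hD, h2, dpEnc_eq]

/-- `zquoPosF ∈ FP`. [folklore] -/
theorem zquoPosF_mem_FP : zquoPosF ∈ FP :=
  fanoutFn_mem_FP (comp_mem_FP divFn_mem_FP (fanoutFn_mem_FP (comp_mem_FP fstF_mem_FP fstF_mem_FP) sndF_mem_FP))
    (comp_mem_FP divFn_mem_FP (fanoutFn_mem_FP
      (comp_mem_FP addFn_mem_FP (fanoutFn_mem_FP (comp_mem_FP sndF_mem_FP fstF_mem_FP)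
        (comp_mem_FP subFn_mem_FP (fanoutFn_mem_FP sndF_mem_FP (const_mem_FP _)))))
      sndF_mem_FP))

/-- **Integer division** `⟨a, d⟩ ↦ dpEnc (ival a / ival d)` on canonical codes, with Lean's
conventions: if `dP ≠ ε` (positive divisor) divide by `dP`; else if `dQ ≠ ε` (negative divisor)
divide by `dQ` and negate; else (`d = 0`) return `0`. [cite: KnuthTAOCP2, §4.3.1] -/
noncomputable def zedivF : List Bool → List Bool :=
  iteFn (isNilFn ∘ fstF ∘ sndF)
    (iteFn (isNilFn ∘ sndF ∘ sndF) (fun _ => dpEnc 0)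
      (zswapF ∘ zquoPosF ∘ fanoutFn fstF (sndF ∘ sndF)))
    (zquoPosF ∘ fanoutFn fstF (fstF ∘ sndF))

/-- **`zedivF ⟨dpEnc x, dpEnc d⟩ = dpEnc (x / d)`** (`Int.ediv`). [folklore] -/
theorem zedivF_dpEnc (x d : ℤ) : zedivF (boolPair (dpEnc x) (dpEnc d)) = dpEnc (x / d) := by
  rcases lt_trichotomy d 0 with hneg | rfl | hpos
  · -- negative divisor: `dP = ε`, `dQ = bin |d|`
    have hP : Com.cP d = [] := by simp [Com.cP, hneg]
    have hQ : Com.cQ d = encodeNat d.natAbs := by simp [Com.cQ, hneg]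
    have hQne : Com.cQ d ≠ [] := by rw [hQ]; exact encodeNat_ne_nil_of_pos (by omega)
    rw [zedivF, iteFn_apply_true (by simp [isNilFn, dpEnc_eq, hP]), iteFn_apply_false (by simp [isNilFn, dpEnc_eq, hQne])]
    simp only [Function.comp_apply, fanoutFn_apply, fstF_boolPair, sndF_boolPair]
    rw [show sndF (dpEnc d) = Com.cQ d by rw [dpEnc_eq, sndF_boolPair], hQ,
      zquoPosF_dpEnc x _ (by rw [bitsToNat_encodeNat]; omega), zswapF_dpEnc, bitsToNat_encodeNat]
    congr 1
    have hd : (d.natAbs : ℤ) = -d := by omega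
    rw [hd, Int.ediv_neg, neg_neg]
  · -- zero divisor
    rw [zedivF, iteFn_apply_true (by simp [isNilFn, dpEnc_zero]), iteFn_apply_true (by simp [isNilFn, dpEnc_zero]), Int.ediv_zero]
  · -- positive divisor
    have hP : Com.cP d = encodeNat d.natAbs := by simp [Com.cP, not_lt.2 hpos.le]
    have hPne : Com.cP d ≠ [] := by rw [hP]; exact encodeNat_ne_nil_of_pos (by omega)
    rw [zedivF, iteFn_apply_false (by simp [isNilFn, dpEnc_eq, hPne])]
    simp only [Function.comp_apply, fanoutFn_apply, fstF_boolPair, sndF_boolPair]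
    rw [show fstF (dpEnc d) = Com.cP d by rw [dpEnc_eq, fstF_boolPair], hP,
      zquoPosF_dpEnc x _ (by rw [bitsToNat_encodeNat]; omega), bitsToNat_encodeNat]
    congr 2
    omega

/-- `zedivF ∈ FP`. [folklore] -/
theorem zedivF_mem_FP : zedivF ∈ FP :=
  iteFn_mem_FP (comp_mem_FP isNilFn_mem_FP (comp_mem_FP fstF_mem_FP sndF_mem_FP))
    (iteFn_mem_FP (comp_mem_FP isNilFn_mem_FP (comp_mem_FP sndF_mem_FP sndF_mem_FP)) (const_mem_FP _)
      (comp_mem_FP zswapF_mem_FP (comp_mem_FP zquoPosF_mem_FP (fanoutFn_mem_FP fstF_mem_FP (comp_mem_FP sndF_mem_FP sndF_mem_FP)))))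
    (comp_mem_FP zquoPosF_mem_FP (fanoutFn_mem_FP fstF_mem_FP (comp_mem_FP fstF_mem_FP sndF_mem_FP)))

/-! ### Saturation at the width of the yardstick -/

/-- **Saturation**: `⟨x, a⟩ ↦ dpEnc (ival a)` if `|bin (⟦aP⟧ + ⟦aQ⟧)| ≤ |x|` (for canonical `a`:
`|ival a| < 2^{|x|}`), and `dpEnc 0` otherwise. [folklore] -/
noncomputable def zcapF : List Bool → List Bool :=
  iteFn (lenLeFn X ∘ fanoutFn fstF (addFn ∘ sndF)) (zcanonF ∘ sndF) (fun _ => dpEnc 0)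

/-- `|bin m| ≤ W ↔ m < 2^W`. [folklore] -/
theorem length_encodeNat_le_iff (m W : ℕ) : (encodeNat m).length ≤ W ↔ m < 2 ^ W := by
  rw [TM2Pass.length_encodeNat_eq_size, Nat.size_le]

/-- **`zcapF ⟨x, dpEnc z⟩`** is `dpEnc z` if `|z| < 2^{|x|}` and `dpEnc 0` otherwise. [folklore] -/
theorem zcapF_dpEnc (x : List Bool) (z : ℤ) :
    zcapF (boolPair x (dpEnc z)) = dpEnc (if z.natAbs < 2 ^ x.length then z else 0) := by
  have hc : (lenLeFn X ∘ fanoutFn fstF (addFn ∘ sndF)) (boolPair x (dpEnc z)) =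
      [decide ((encodeNat z.natAbs).length ≤ x.length)] := by
    simp [dpEnc_eq, addFn, bitsToNat_cP_add_cQ, lenLeFn_boolPair]
  by_cases h : z.natAbs < 2 ^ x.length
  · rw [zcapF, iteFn_apply_true (by rw [hc]; simp [(length_encodeNat_le_iff _ _).2 h]), if_pos h]
    simp
  · rw [zcapF, iteFn_apply_false (by rw [hc]; simpa [length_encodeNat_le_iff] using h), if_neg h]

/-- `zcapF ∈ FP`. [folklore] -/
theorem zcapF_mem_FP : zcapF ∈ FP :=
  iteFn_mem_FP (comp_mem_FP (lenLeFn_mem_FP X) (fanoutFn_mem_FP fstF_mem_FP (comp_mem_FP addFn_mem_FP sndF_mem_FP)))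
    (comp_mem_FP zcanonF_mem_FP sndF_mem_FP) (const_mem_FP _)

/-- The saturation test is one-bit. [folklore] -/
theorem oneBit_zcapTest : OneBit (lenLeFn X ∘ fanoutFn fstF (addFn ∘ sndF)) := fun z => by
  rcases lenLeFn_eq_or X (fanoutFn fstF (addFn ∘ sndF) z) with h | h
  · exact ⟨true, h⟩
  · exact ⟨false, h⟩

/-- **The output of `zcapF` is short whatever the input**: `|zcapF w| ≤ 2 |fstF w| + 2`. [folklore] -/
theorem length_zcapF_le (w : List Bool) : (zcapF w).length ≤ 2 * (fstF w).length + 2 := by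
  rw [zcapF, iteFn_of_oneBit oneBit_zcapTest]
  split_ifs with h
  · -- the test passed: `|bin (P + Q)| ≤ |x|`, and the canonical form has `≤ |bin (P+Q)|` numeral bits
    have hc : lenLeFn X (boolPair (fstF w) (addFn (sndF w))) = [true] := by simpa [fanoutFn_apply] using h
    rw [lenLeFn_boolPair] at hc
    have hle : (addFn (sndF w)).length ≤ (fstF w).length := by simpa using hc
    rw [Function.comp_apply, zcanonF_eq]
    have h1 := length_dpEnc_le_two_mul (ival (sndF w))
    have h2 : (encodeNat (ival (sndF w)).natAbs).length ≤ (addFn (sndF w)).length := by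
      unfold addFn ival fstF sndF
      exact length_encodeNat_mono (by omega)
    omega
  · rw [dpEnc_zero, length_boolPair]; simp

/-- `zcapF` of a pair depends only on the yardstick's length and the operand. [folklore] -/
theorem zcapF_boolPair_congr {x x' : List Bool} (h : x.length = x'.length) (a : List Bool) :
    zcapF (boolPair x a) = zcapF (boolPair x' a) := by
  rw [zcapF, iteFn_of_oneBit oneBit_zcapTest, iteFn_of_oneBit oneBit_zcapTest]
  simp [lenLeFn_boolPair, h]

/-! ### Conversions with the sign–magnitude entry code `⟨[z < 0], bin |z|⟩` -/

/-- **`ofSMFn` lands on the canonical code**: `ofSMFn ⟨[z < 0], bin |z|⟩ = dpEnc z`. [folklore] -/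
theorem ofSMFn_encode (z : ℤ) : ofSMFn (boolPair [decide (z < 0)] (encodeNat z.natAbs)) = dpEnc z := by
  rw [ofSMFn_apply, dpEnc_eq]
  by_cases h : z < 0
  · simp [Com.cP, Com.cQ, h]
  · simp [Com.cP, Com.cQ, h]

/-- From the difference-pair code to the sign–magnitude code: sign bit `[aQ ≠ ε]`, magnitude
`bin (⟦aP⟧ + ⟦aQ⟧)`. [folklore] -/
noncomputable def signMagOfZF : List Bool → List Bool := fanoutFn (notFn (isNilFn ∘ sndF)) addFn

/-- `signMagOfZF (dpEnc z) = ⟨[z < 0], bin |z|⟩`. [folklore] -/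
theorem signMagOfZF_dpEnc (z : ℤ) : signMagOfZF (dpEnc z) = boolPair [decide (z < 0)] (encodeNat z.natAbs) := by
  rw [signMagOfZF, fanoutFn_apply, dpEnc_eq, addFn_boolPair, bitsToNat_cP_add_cQ,
    notFn_apply (b := decide (Com.cQ z = [])) (by simp [isNilFn])]
  congr 2
  unfold Com.cQ
  split_ifs with h
  · have : encodeNat z.natAbs ≠ [] := encodeNat_ne_nil_of_pos (by omega)
    simp [h, this]
  · simp [h]

/-- `signMagOfZF ∈ FP`. [folklore] -/
theorem signMagOfZF_mem_FP : signMagOfZF ∈ FP :=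
  fanoutFn_mem_FP (notFn_mem_FP (comp_mem_FP isNilFn_mem_FP sndF_mem_FP)) addFn_mem_FP

/-- `|signMagOfZF w| ≤ zlen w + 5` on every input. [folklore] -/
theorem length_signMagOfZF_le (w : List Bool) : (signMagOfZF w).length ≤ zlen w + 5 := by
  rw [signMagOfZF, fanoutFn_apply, length_boolPair, (oneBit_notFn (oneBit_isNilFn.comp sndF)).length_eq]
  have : (addFn w).length ≤ zlen w + 1 := by
    unfold addFn zlen fstF sndF
    refine (length_encodeNat_add_le_max _ _).trans ?_
    omega
  omega

/-! ### Output lengths of the arithmetic bricks -/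

/-- `|zaddF ⟨a, b⟩| ≤ 2 max (zlen a) (zlen b) + 4`. [folklore] -/
theorem length_zaddF_le (a b : List Bool) : (zaddF (boolPair a b)).length ≤ 2 * max (zlen a) (zlen b) + 4 := by
  rw [zaddF_boolPair]
  refine (length_dpEnc_le_two_mul _).trans ?_
  have h : (encodeNat (ival a + ival b).natAbs).length ≤ max (zlen a) (zlen b) + 1 := by
    refine (length_encodeNat_mono (Int.natAbs_add_le _ _)).trans ?_
    refine (_root_.Literature.Computability.Complexity.length_encodeNat_add_le _ _).trans ?_
    have h1 := length_encodeNat_natAbs_ival_le a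
    have h2 := length_encodeNat_natAbs_ival_le b
    omega
  omega

/-- `|zsubF ⟨a, b⟩| ≤ 2 max (zlen a) (zlen b) + 4`. [folklore] -/
theorem length_zsubF_le (a b : List Bool) : (zsubF (boolPair a b)).length ≤ 2 * max (zlen a) (zlen b) + 4 := by
  rw [zsubF_boolPair]
  refine (length_dpEnc_le_two_mul _).trans ?_
  have h : (encodeNat (ival a - ival b).natAbs).length ≤ max (zlen a) (zlen b) + 1 := by
    refine (length_encodeNat_mono (Int.natAbs_sub_le _ _)).trans ?_
    refine (_root_.Literature.Computability.Complexity.length_encodeNat_add_le _ _).trans ?_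
    have h1 := length_encodeNat_natAbs_ival_le a
    have h2 := length_encodeNat_natAbs_ival_le b
    omega
  omega

/-- `|zmulF ⟨a, b⟩| ≤ 2 (zlen a + zlen b) + 2`. [folklore] -/
theorem length_zmulF_le (a b : List Bool) : (zmulF (boolPair a b)).length ≤ 2 * (zlen a + zlen b) + 2 := by
  rw [zmulF_boolPair]
  refine (length_dpEnc_le_two_mul _).trans ?_
  have h : (encodeNat (ival a * ival b).natAbs).length ≤ zlen a + zlen b := by
    rw [Int.natAbs_mul]
    refine (_root_.Literature.Computability.Complexity.length_encodeNat_mul_le _ _).trans ?_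
    have h1 := length_encodeNat_natAbs_ival_le a
    have h2 := length_encodeNat_natAbs_ival_le b
    omega
  omega

/-- The numeral length of a canonical code bounds that of any quotient. [folklore] -/
theorem zlen_dpEnc_ediv_le (x d : ℤ) : zlen (dpEnc (x / d)) ≤ zlen (dpEnc x) := by
  rw [zlen_dpEnc, zlen_dpEnc]
  exact Com.length_encodeNat_natAbs_ediv_le x d

/-- The length of a canonical code is at most twice its numeral length plus `2`. [folklore] -/
theorem length_dpEnc_le_zlen (z : ℤ) : (dpEnc z).length ≤ 2 * zlen (dpEnc z) + 2 := by
  rw [zlen_dpEnc]; exact length_dpEnc_le_two_mul z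

end Brick

end Literature.Computability.Complexity
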